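import Literature.MathematicalPhysics.QuantumFieldTheory.Balaban1983to89.B9Eq340StepLasso
import Literature.MathematicalPhysics.QuantumFieldTheory.Balaban1983to89.Node00.OpsYLocalInverse
import Literature.MathematicalPhysics.QuantumFieldTheory.Balaban1983to89.Node00.OpsYRecordV4

/-!
# NODE 00 — `G′_□(U)` IS LOCAL IN `U` at def-Y's GENUINE transporters (walk-letter instance, FILE A-1)

[B9] p. 410 L14–16: *"A propagator `G′_□` depends on `U` restricted to `Ω₀(□) ⊂ □̃⁵`, and the operator `K(h)` is semi-local, hence a term in (3.90)
corresponding to a walk `ω = (□₀, □₁, …, □_n)` depends on `U` restricted to `□̃₀⁵ ∪ □̃₁⁵ ∪ … ∪ □̃_n⁵`"* — `G′_□(U)` depends on the configuration `U`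
only through the bond variables near □̃. (Edition 2: citation LOCATORS corrected after the referee's read of FILE A-0 — the localisation sentence is
p. 410, not «(3.81) p. 407»; `G′_□` is introduced pp. 408–409, not «(3.79) p. 406»; no declaration changed.)  FILE A-0 (`Node00.OpsYLocalInverse`) proved the shape `GsqY_congr_of_agree` for an ABSTRACT transporter letter
`par`.  This module discharges the transporter clause for def-Y's GENUINE letters — the taxi transporter `parSY` (`U(Γ_{z,z′})`,
`Node00.OpsYTransport`) and the record's symmetrised transporter `parSymY` (`Node00.OpsYRecordV4`, R7: `U(Γ_{w,z}) = U(Γ_{z,w})⁻¹`) — using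
n06's signed-step reading `parTaxiV_eq_stepRun` (`B9Eq340StepLasso`), and states everything once for any transporter letter with the
locality property `ParLocalY i par` («`par U z w` reads `U` only on the taxi runs `z ⇄ w`»), of which both genuine letters are instances:

* §1 `stepRun_congr_of_agree`: a signed step run reads `U` exactly on its rung bonds `rungSites l w`; hence `parTaxiV_congr_of_agree`;
* §2 `taxiBondsY i z z′` (the rung bonds of the taxi steps `z → z′`), `AgreeRunY i U U′ z w` («`U = U′` on the taxi runs `z → w` and `w → z`»),
  `ParLocalY i par`, its instances `parLocalY_parSY`, `parLocalY_parSymY`, the agreement predicate `AgreeNearY i D U U′` («`U = U′` on the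
  bonds at the sites of `D` and on the taxi runs of `D`'s averaging pairs through their block corners»; the instance's `rd.Agree` candidate —
  the geometric inclusion «those bonds ⊂ □̃⁵» is cube-cover geometry, not asserted here), and ★ `deltaPrimeAY_apply_congr_of_parLocalY`,
  `KhY_apply_congr_of_parLocalY`: `Δ′_a(U)λ`, `K(h)(U)λ` agree with their `U′`-versions at every site of `D`;
* §3 ★★ `GsqY_congr_of_parLocalY : ParLocalY i par → AgreeNearY i D U U′ → GsqY i par D U = GsqY i par D U′` — the `Locality.gsq` clause of
  `B9Cor38Whole.Locality` for the genuine instance — with the regime object `padDeltaY`, its `IsUnit` transfer, the `Locality.kgh` shape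
  `K(g)(U) G′_□(U) M_g` (pointwise on `D′ ⊇ D`) and the (3.87) summand `M_g G′_□(U) M_g`; named specialisations `GsqY_parSY_congr`,
  `GsqY_parSymY_congr`, `padDeltaY_parSymY_congr`, `isUnit_padDeltaY_parSymY_iff`.

Gauge group SU(N) only through def-Y's carriers; no continuum limit, no OS axioms, no mass gap, no claim on the Clay problem.
-/

namespace Literature.MathematicalPhysics.QuantumFieldTheory.Balaban1983to89.Node00.OpsYLocalInverseAgree

open B6KLevelCensusIndexV1 (KIdx)
open B6GlobalChartV1 (PV boxEquiv)
open B9BackgroundsKLevelV1 (CfgV1)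
open B9Eq340StepLasso (stepRun rungSites taxiSteps parTaxiV_eq_stepRun)
open B9Thm37CubeCoverCommutators (cutMulY cutMulY_apply cutCommY_apply KhY KhY_def)
open OpsYLocalInverse (GsqY padDeltaY GsqY_congr_of_apply padDeltaY_congr compr_congr_of_apply)

/-! ## §1 A signed step run reads `U` exactly on its rung bonds -/

section Steps

variable {P : Params} {𝔸 : Type} [NormedRing 𝔸]

/-- ★ two configurations agreeing on the rung bonds of a signed step path give the same step run.
[cite: Balaban1985BackgroundPropagators, (3.40) p.397, (3.3) p.391, bookkeeping] -/
theorem stepRun_congr_of_agree {U U' : CfgV1 P 𝔸} :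
    ∀ (l : List (Fin P.d × Bool)) (w : Site P 0), (∀ r ∈ rungSites l w, U r.2.1 r.1 = U' r.2.1 r.1) → stepRun U l w = stepRun U' l w
  | [], _, _ => rfl
  | (ν, true) :: l, w, h => by
      simp only [stepRun]
      rw [h (w, ν, true) (by simp [rungSites]),
        stepRun_congr_of_agree l (w.shift ν) fun r hr => h r (by simp [rungSites, hr])]
  | (ν, false) :: l, w, h => by
      simp only [stepRun]
      rw [h (w.unshift ν, ν, false) (by simp [rungSites]),
        stepRun_congr_of_agree l (w.unshift ν) fun r hr => h r (by simp [rungSites, hr])]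

/-- hence def-Y's taxi transporter `U(Γ_{x,z})` reads `U` exactly on the rung bonds of its taxi steps.
[cite: Balaban1985BackgroundPropagators, (3.40) p.397] -/
theorem parTaxiV_congr_of_agree {U U' : CfgV1 P 𝔸} (x z : Site P 0)
    (h : ∀ r ∈ rungSites (taxiSteps (List.finRange P.d) x z) x, U r.2.1 r.1 = U' r.2.1 r.1) :
    parTaxiV U x z = parTaxiV U' x z := by
  rw [parTaxiV_eq_stepRun, parTaxiV_eq_stepRun]
  exact stepRun_congr_of_agree _ _ h

end Steps

/-! ## §2 At def-Y's index: the genuine transporter letter and `G′_□(U)` -/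

section Index

variable {𝔸 : Type} [NormedRing 𝔸] [NormedAlgebra ℂ 𝔸] [CompleteSpace 𝔸]
variable {d ℓ : ℕ} {hd : 1 ≤ d + 1} {hL : Odd (ℓ + 1) ∧ 1 < ℓ + 1} {b₀ b₁ : ℝ}
variable (i : KIdx d ℓ hd hL b₀ b₁)

/-- the bonds read by the taxi transporter between two box-chart sites: the rung bonds of the taxi steps from `chart⁻¹ z` to `chart⁻¹ z′`
(torus site × direction × orientation). [cite: Balaban1985BackgroundPropagators, (3.40) p.397, dictionary] -/
noncomputable def taxiBondsY (z z' : SiteY i) : List (Site (PV d ℓ i.m i.K hd hL) 0 × Fin (d + 1) × Bool) :=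
  rungSites (taxiSteps (List.finRange (d + 1)) ((boxEquiv i.hN).symm z) ((boxEquiv i.hN).symm z')) ((boxEquiv i.hN).symm z)

/-- ★ def-Y's genuine site transporter `parSY` reads `U` exactly on `taxiBondsY i z z′`. [cite: Balaban1985BackgroundPropagators, (3.40) p.397] -/
theorem parSY_congr_of_agree {U U' : CfgY 𝔸 i} (z z' : SiteY i) (h : ∀ r ∈ taxiBondsY i z z', U r.2.1 r.1 = U' r.2.1 r.1) :
    parSY i U z z' = parSY i U' z z' :=
  parTaxiV_congr_of_agree _ _ h

/-- **agreement on a taxi run, both ways**: `U = U′` on the rung bonds of the taxi steps `z → w` and of `w → z` (the symmetrised transporter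
reads the reversed run). [cite: Balaban1985BackgroundPropagators, (3.40) p.397, dictionary] -/
def AgreeRunY (U U' : CfgY 𝔸 i) (z w : SiteY i) : Prop :=
  (∀ r ∈ taxiBondsY i z w, U r.2.1 r.1 = U' r.2.1 r.1) ∧ (∀ r ∈ taxiBondsY i w z, U r.2.1 r.1 = U' r.2.1 r.1)

/-- `AgreeRunY` is symmetric in the configurations. [cite: Balaban1985BackgroundPropagators, (3.40) p.397, bookkeeping] -/
theorem AgreeRunY.symm {U U' : CfgY 𝔸 i} {z w : SiteY i} (h : AgreeRunY i U U' z w) : AgreeRunY i U' U z w :=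
  ⟨fun r hr => (h.1 r hr).symm, fun r hr => (h.2 r hr).symm⟩

/-- `AgreeRunY` is symmetric in the endpoints. [cite: Balaban1985BackgroundPropagators, (3.40) p.397, bookkeeping] -/
theorem AgreeRunY.swap {U U' : CfgY 𝔸 i} {z w : SiteY i} (h : AgreeRunY i U U' z w) : AgreeRunY i U U' w z :=
  ⟨h.2, h.1⟩

/-- **LOCALITY OF A TRANSPORTER LETTER**: `par U z w` reads `U` only on the taxi runs `z ⇄ w`.
[cite: Balaban1985BackgroundPropagators, (3.40) p.397, p.410 L14–15, dictionary] -/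
def ParLocalY (par : SiteParY 𝔸 i) : Prop :=
  ∀ ⦃U U' : CfgY 𝔸 i⦄ ⦃z w : SiteY i⦄, AgreeRunY i U U' z w → par U z w = par U' z w

/-- ★ def-Y's genuine taxi transporter `parSY` is local. [cite: Balaban1985BackgroundPropagators, (3.40) p.397] -/
theorem parLocalY_parSY : ParLocalY i (parSY i : SiteParY 𝔸 i) :=
  fun _ _ z w h => parSY_congr_of_agree i z w h.1

/-- ★ the record's symmetrised transporter `parSymY` (R7) is local. [cite: Balaban1985BackgroundPropagators, (3.40) p.397, (3.24) p.394] -/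
theorem parLocalY_parSymY : ParLocalY i (parSymY i : SiteParY 𝔸 i) := by
  intro U U' z w h
  by_cases hle : toLex z.1 ≤ toLex w.1
  · rw [parSymY_of_le hle, parSymY_of_le hle, parSY_congr_of_agree i z w h.1]
  · rw [parSymY_of_not_le hle, parSymY_of_not_le hle, parSY_congr_of_agree i w z h.2]

variable {i} in
/-- the averaging transporter `par U z c · par U c w` through the block corner `c` reads `U` on the two taxi runs `z ⇄ c`, `c ⇄ w`.
[cite: Balaban1985BackgroundPropagators, (3.19) p.393, (3.24) p.394] -/
theorem avgTrY_congr_of_parLocalY {par : SiteParY 𝔸 i} (hpar : ParLocalY i par) {U U' : CfgY 𝔸 i} {z w : SiteY i}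
    (h₁ : AgreeRunY i U U' z (cornerY i (levY i z) z)) (h₂ : AgreeRunY i U U' (cornerY i (levY i z) z) w) :
    avgTrY i par U z w = avgTrY i par U' z w := by
  rw [avgTrY, avgTrY, hpar h₁, hpar h₂]

/-- **the agreement predicate of the genuine instance**: `U = U′` (i) at the bonds `U_μ(z)`, `U_μ(z − e_μ)` of every site `z ∈ D` and (ii) on the
taxi runs `z ⇄ c(z) ⇄ w` of every averaging pair `(z, w)`, `z ∈ D`, `avgCoeffY z w ≠ 0` (print: all inside □̃⁵ — the geometric inclusion is the
cube cover's, not asserted here). [cite: Balaban1985BackgroundPropagators, p.410 L14–15 («G′_□ depends on U restricted to Ω₀(□) ⊂ □̃⁵»), dictionary] -/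
def AgreeNearY (D : Finset (SiteY i)) (U U' : CfgY 𝔸 i) : Prop :=
  (∀ z ∈ D, ∀ μ, UboxY i U μ z = UboxY i U' μ z ∧ UboxY i U μ ((shiftY i μ).symm z) = UboxY i U' μ ((shiftY i μ).symm z)) ∧
  (∀ z ∈ D, ∀ w, avgCoeffY i z w ≠ 0 → AgreeRunY i U U' z (cornerY i (levY i z) z) ∧ AgreeRunY i U U' (cornerY i (levY i z) z) w)

/-- `AgreeNearY` is reflexive. [cite: Balaban1985BackgroundPropagators, p.410 L14–15, bookkeeping] -/
theorem agreeNearY_refl (D : Finset (SiteY i)) (U : CfgY 𝔸 i) : AgreeNearY i D U U :=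
  ⟨fun _ _ _ => ⟨rfl, rfl⟩, fun _ _ _ _ => ⟨⟨fun _ _ => rfl, fun _ _ => rfl⟩, ⟨fun _ _ => rfl, fun _ _ => rfl⟩⟩⟩

/-- `AgreeNearY` is symmetric. [cite: Balaban1985BackgroundPropagators, p.410 L14–15, bookkeeping] -/
theorem AgreeNearY.symm {D : Finset (SiteY i)} {U U' : CfgY 𝔸 i} (h : AgreeNearY i D U U') : AgreeNearY i D U' U :=
  ⟨fun z hz μ => ⟨((h.1 z hz μ).1).symm, ((h.1 z hz μ).2).symm⟩,
    fun z hz w hw => ⟨(h.2 z hz w hw).1.symm, (h.2 z hz w hw).2.symm⟩⟩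

/-- `AgreeNearY` is monotone in the site set. [cite: Balaban1985BackgroundPropagators, p.410 L14–15, bookkeeping] -/
theorem AgreeNearY.mono {D D' : Finset (SiteY i)} (hDD : D ⊆ D') {U U' : CfgY 𝔸 i} (h : AgreeNearY i D' U U') : AgreeNearY i D U U' :=
  ⟨fun z hz => h.1 z (hDD hz), fun z hz => h.2 z (hDD hz)⟩

variable {i} in
/-- ★ under `AgreeNearY`, `Δ′_a(U)` and `Δ′_a(U′)` at a local transporter letter agree at every site of `D` on every input.
[cite: Balaban1985BackgroundPropagators, (3.24) p.394, p.410 L14–15] -/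
theorem deltaPrimeAY_apply_congr_of_parLocalY {par : SiteParY 𝔸 i} (hpar : ParLocalY i par) {D : Finset (SiteY i)} {U U' : CfgY 𝔸 i}
    (h : AgreeNearY i D U U') (Λ : SiteY i → 𝔸) {z : SiteY i} (hz : z ∈ D) : deltaPrimeAY i par U Λ z = deltaPrimeAY i par U' Λ z := by
  rw [deltaPrimeAY_apply, deltaPrimeAY_apply]
  have hlap : lapS i U Λ z = lapS i U' Λ z := by
    simp only [lapS, cdsS, cdS, B9Eq39Adjoint.covD, B9Eq39Adjoint.covDstar]
    refine Finset.sum_congr rfl fun μ _ => ?_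
    rw [(h.1 z hz μ).1, (h.1 z hz μ).2]
  rw [hlap]
  congr 1
  refine Finset.sum_congr rfl fun w _ => ?_
  by_cases hw : avgCoeffY i z w = 0
  · rw [hw, Complex.ofReal_zero, zero_smul, zero_smul]
  · rw [avgTrY_congr_of_parLocalY hpar (h.2 z hz w hw).1 (h.2 z hz w hw).2]

variable {i} in
/-- ★ and so do print's commutators `K(g)(U)`, `K(g)(U′)` of (3.88), for every cut-off `g` and input.
[cite: Balaban1985BackgroundPropagators, (3.88) p.409, p.410 L15 («K(h) is semi-local»)] -/
theorem KhY_apply_congr_of_parLocalY {par : SiteParY 𝔸 i} (hpar : ParLocalY i par) {D : Finset (SiteY i)} {U U' : CfgY 𝔸 i}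
    (h : AgreeNearY i D U U') (g : SiteY i → ℝ) (Λ : SiteY i → 𝔸) {z : SiteY i} (hz : z ∈ D) :
    KhY i par g U Λ z = KhY i par g U' Λ z := by
  rw [KhY_def, KhY_def, cutCommY_apply, cutCommY_apply, deltaPrimeAY_apply_congr_of_parLocalY hpar h Λ hz,
    deltaPrimeAY_apply_congr_of_parLocalY hpar h (cutMulY g Λ) hz]

/-- `Δ′_a` at the genuine taxi transporter, pointwise on `D`. [cite: Balaban1985BackgroundPropagators, (3.24) p.394, p.410 L14–15] -/
theorem deltaPrimeAY_parSY_apply_congr {D : Finset (SiteY i)} {U U' : CfgY 𝔸 i} (h : AgreeNearY i D U U') (Λ : SiteY i → 𝔸)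
    {z : SiteY i} (hz : z ∈ D) : deltaPrimeAY i (parSY i) U Λ z = deltaPrimeAY i (parSY i) U' Λ z :=
  deltaPrimeAY_apply_congr_of_parLocalY (parLocalY_parSY i) h Λ hz

/-- `Δ′_a` at the record's symmetrised transporter, pointwise on `D`. [cite: Balaban1985BackgroundPropagators, (3.24) p.394, p.410 L14–15] -/
theorem deltaPrimeAY_parSymY_apply_congr {D : Finset (SiteY i)} {U U' : CfgY 𝔸 i} (h : AgreeNearY i D U U') (Λ : SiteY i → 𝔸)
    {z : SiteY i} (hz : z ∈ D) : deltaPrimeAY i (parSymY i) U Λ z = deltaPrimeAY i (parSymY i) U' Λ z :=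
  deltaPrimeAY_apply_congr_of_parLocalY (parLocalY_parSymY i) h Λ hz

end Index

/-! ## §3 `G′_□(U)`, its regime object and `K(h_□)G′_□h_□` are local in `U` -/

section Local

variable {𝔸 : Type} [NormedRing 𝔸] [NormedAlgebra ℂ 𝔸] [CompleteSpace 𝔸]
variable {d ℓ : ℕ} {hd : 1 ≤ d + 1} {hL : Odd (ℓ + 1) ∧ 1 < ℓ + 1} {b₀ b₁ : ℝ}
variable {i : KIdx d ℓ hd hL b₀ b₁}

/-- ★★ **`Locality.gsq` FOR THE GENUINE INSTANCE**: at a local transporter letter, configurations agreeing near □̃ (`AgreeNearY`) have the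
same local cube inverse `G′_□(U) = G′_□(U′)`. [cite: Balaban1985BackgroundPropagators, p.410 L14–15, pp.408–409 (G′_□)] -/
theorem GsqY_congr_of_parLocalY {par : SiteParY 𝔸 i} (hpar : ParLocalY i par) {D : Finset (SiteY i)} {U U' : CfgY 𝔸 i}
    (h : AgreeNearY i D U U') : GsqY i par D U = GsqY i par D U' :=
  GsqY_congr_of_apply i par D fun Λ _ _ hz => deltaPrimeAY_apply_congr_of_parLocalY hpar h Λ hz

/-- the regime object `padDeltaY` (padded compression of `Δ′_a(U)` to □̃) is local in the same sense.
[cite: Balaban1985BackgroundPropagators, p.410 L14–15, bookkeeping] -/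
theorem padDeltaY_congr_of_parLocalY {par : SiteParY 𝔸 i} (hpar : ParLocalY i par) {D : Finset (SiteY i)} {U U' : CfgY 𝔸 i}
    (h : AgreeNearY i D U U') : padDeltaY i par D U = padDeltaY i par D U' :=
  padDeltaY_congr i par D (compr_congr_of_apply i D fun Λ _ _ hz => deltaPrimeAY_apply_congr_of_parLocalY hpar h Λ hz)

/-- hence the invertibility hypothesis transfers between agreeing configurations. [cite: Balaban1985BackgroundPropagators, p.410 L14–15, bookkeeping] -/
theorem isUnit_padDeltaY_iff_of_parLocalY {par : SiteParY 𝔸 i} (hpar : ParLocalY i par) {D : Finset (SiteY i)} {U U' : CfgY 𝔸 i}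
    (h : AgreeNearY i D U U') : IsUnit (padDeltaY i par D U) ↔ IsUnit (padDeltaY i par D U') := by
  rw [padDeltaY_congr_of_parLocalY hpar h]

/-- ★ **`Locality.kgh` SHAPE FOR THE GENUINE INSTANCE, pointwise**: for a cut-off `g` and configurations agreeing near the larger site set
`D′ ⊇ D`, the composite `K(g)(U) G′_□(U) M_g` agrees with its `U′`-version at every site of `D′` on every input.
[cite: Balaban1985BackgroundPropagators, p.410 L14–15 («G′_□ depends on U restricted to Ω₀(□) ⊂ □̃⁵ … K(h) is semi-local»), (3.88) p.409] -/
theorem KhY_GsqY_cutMulY_apply_congr_of_parLocalY {par : SiteParY 𝔸 i} (hpar : ParLocalY i par) {D D' : Finset (SiteY i)} (hDD : D ⊆ D')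
    {U U' : CfgY 𝔸 i} (h : AgreeNearY i D' U U') (g : SiteY i → ℝ) (Λ : SiteY i → 𝔸) {z : SiteY i} (hz : z ∈ D') :
    (KhY i par g U * GsqY i par D U * cutMulY g : Module.End ℂ (SiteY i → 𝔸)) Λ z
      = (KhY i par g U' * GsqY i par D U' * cutMulY g : Module.End ℂ (SiteY i → 𝔸)) Λ z := by
  rw [Module.End.mul_apply, Module.End.mul_apply, Module.End.mul_apply, Module.End.mul_apply,
    GsqY_congr_of_parLocalY hpar (h.mono i hDD), KhY_apply_congr_of_parLocalY hpar h g _ hz]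

/-- and the (3.87) summand `M_g G′_□(U) M_g` is local outright (as an operator). [cite: Balaban1985BackgroundPropagators, (3.87) p.409, p.410 L14–15] -/
theorem cutMulY_GsqY_cutMulY_congr_of_parLocalY {par : SiteParY 𝔸 i} (hpar : ParLocalY i par) {D : Finset (SiteY i)} {U U' : CfgY 𝔸 i}
    (h : AgreeNearY i D U U') (g : SiteY i → ℝ) : cutMulY g * GsqY i par D U * cutMulY g = cutMulY g * GsqY i par D U' * cutMulY g := by
  rw [GsqY_congr_of_parLocalY hpar h]

variable (i)

/-- ★★ `G′_□(U) = G′_□(U′)` at def-Y's genuine taxi transporter `parSY`. [cite: Balaban1985BackgroundPropagators, p.410 L14–15, pp.408–409 (G′_□)] -/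
theorem GsqY_parSY_congr {D : Finset (SiteY i)} {U U' : CfgY 𝔸 i} (h : AgreeNearY i D U U') :
    GsqY i (parSY i) D U = GsqY i (parSY i) D U' :=
  GsqY_congr_of_parLocalY (parLocalY_parSY i) h

/-- ★★ `G′_□(U) = G′_□(U′)` at the record's symmetrised transporter `parSymY` (R7). [cite: Balaban1985BackgroundPropagators, p.410 L14–15, pp.408–409 (G′_□)] -/
theorem GsqY_parSymY_congr {D : Finset (SiteY i)} {U U' : CfgY 𝔸 i} (h : AgreeNearY i D U U') :
    GsqY i (parSymY i) D U = GsqY i (parSymY i) D U' :=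
  GsqY_congr_of_parLocalY (parLocalY_parSymY i) h

/-- the regime object at the record's transporter. [cite: Balaban1985BackgroundPropagators, p.410 L14–15, bookkeeping] -/
theorem padDeltaY_parSymY_congr {D : Finset (SiteY i)} {U U' : CfgY 𝔸 i} (h : AgreeNearY i D U U') :
    padDeltaY i (parSymY i) D U = padDeltaY i (parSymY i) D U' :=
  padDeltaY_congr_of_parLocalY (parLocalY_parSymY i) h

/-- and its invertibility transfer. [cite: Balaban1985BackgroundPropagators, p.410 L14–15, bookkeeping] -/
theorem isUnit_padDeltaY_parSymY_iff {D : Finset (SiteY i)} {U U' : CfgY 𝔸 i} (h : AgreeNearY i D U U') :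
    IsUnit (padDeltaY i (parSymY i) D U) ↔ IsUnit (padDeltaY i (parSymY i) D U') :=
  isUnit_padDeltaY_iff_of_parLocalY (parLocalY_parSymY i) h

end Local

end Literature.MathematicalPhysics.QuantumFieldTheory.Balaban1983to89.Node00.OpsYLocalInverseAgree
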